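import Mathlib
import HarnessLib
import Summits.ValiantsHypothesis.ValiantsHypothesis.Theses.MonotoneRestoration
import Literature.Computability.AlgebraicComplexity.ArithCircuit
import Literature.Computability.AlgebraicComplexity.ArithCircuitProofs
import Literature.Computability.AlgebraicComplexity.MonotoneStructure
import Literature.Computability.AlgebraicComplexity.PermanentIrreducible
import Literature.ModelTheory.FiniteModelTheory.CkEquiv
import Summits.ValiantsHypothesis.ValiantsHypothesis.Theorems.MonotoneRestorationMonotoneRestorationQPCosetCount
import Summits.ValiantsHypothesis.ValiantsHypothesis.Theorems.MonotoneRestorationMonotoneRestorationQPSymmetricLB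
import Summits.ValiantsHypothesis.ValiantsHypothesis.Theorems.MonotoneRestorationMonotoneRestorationQPSupportSymmetrisation
import Summits.ValiantsHypothesis.ValiantsHypothesis.Theorems.MonotoneRestorationMonotoneRestorationQPSparseRegime
import Summits.ValiantsHypothesis.ValiantsHypothesis.Theorems.MonotoneRestorationMonotoneRestorationQPBeta
import Literature.Computability.AlgebraicComplexity.SymmetricArithCircuit
import Literature.Computability.AlgebraicComplexity.DawarWilsenach2025Proofs
import Literature.GroupTheory.PermutationGroups.SmallIndexSubgroups
import Summits.ValiantsHypothesis.ValiantsHypothesis.Theorems.MonotoneRestorationQP.Negative.LoadBearing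
import Summits.ValiantsHypothesis.ValiantsHypothesis.Theorems.MonotoneRestorationMonotoneRestorationQPPermSupportCount

/-! TTRL-lite variant V19133 of stmt-ValiantsHypothesis-15886

(`stub_esymmRowSums_structure` of crux `MonotoneRestorationQP`, move `lemma_proposal`):
the independent row/column permutation `(i, j) ↦ (σ i, τ j)` of the `n × n` variable matrix over
`ℝ≥0` sends the `i`-th row sum `R_i = Σ_j x_{i,j}` to the `σ i`-th row sum `R_{σ i}` — the
renaming step (`h`) of the bi-permutation-invariance conjunct of the parent statement.
Proof: `rename` is a ring homomorphism (`map_sum`, `rename_X`), then reindex the sum by the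
bijection `τ` (`Equiv.sum_comp`).  No new definitions, no named facts. -/

-- `Summit.ValiantsHypothesis.ValiantsHypothesis.…` is the tree's mandated single-conjunct layout
-- (Sub = Summit), so the duplicated namespace component is intended.
set_option linter.dupNamespace false

namespace Summit.ValiantsHypothesis.ValiantsHypothesis.Theorems

open Summit.ValiantsHypothesis.ValiantsHypothesis.Theses.MonotoneRestoration
open Literature.Computability.AlgebraicComplexity

/-- TTRL-lite variant V19133 of `stub_esymmRowSums_structure` (stmt-ValiantsHypothesis-15886):
for permutations `σ τ` of `Fin n` and a row index `i`, renaming the variables of the `n × n`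
matrix by `(p.1, p.2) ↦ (σ p.1, τ p.2)` maps the row sum `Σ_j X (i, j)` (over `ℝ≥0`) to the row
sum `Σ_j X (σ i, j)`.  `rename` is a ring hom (`map_sum`, `rename_X`) and the resulting sum
`Σ_j X (σ i, τ j)` is reindexed along the bijection `τ` (`Equiv.sum_comp`). [folklore] -/
theorem stub_esymmRowSums_structure_var19133 : ∀ (n : ℕ) (σ τ : Equiv.Perm (Fin n)) (i : Fin n), MvPolynomial.rename (fun p : Fin n × Fin n => (σ p.1, τ p.2)) (∑ j : Fin n, (MvPolynomial.X (i, j) : MvPolynomial (Fin n × Fin n) NNReal)) = ∑ j : Fin n, MvPolynomial.X (σ i, j) := by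
  intro n σ τ i
  rw [map_sum]
  simp only [MvPolynomial.rename_X]
  exact Equiv.sum_comp τ (fun j => (MvPolynomial.X (σ i, j) : MvPolynomial (Fin n × Fin n) NNReal))

end Summit.ValiantsHypothesis.ValiantsHypothesis.Theorems
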